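import Summits.ValiantsHypothesis.ValiantsHypothesis.Theses.DivisionGap
import Summits.ValiantsHypothesis.ValiantsHypothesis.Theorems.DivisionGapDefs
import Summits.ValiantsHypothesis.ValiantsHypothesis.Theorems.DivisionGapPerDivisionHardStubBlockSubstFacePer
import Summits.ValiantsHypothesis.ValiantsHypothesis.Theorems.DivisionGapPerDivisionHardStubDescent
import Summits.ValiantsHypothesis.ValiantsHypothesis.Theorems.DivisionGapPerDivisionHardStubFibreArith
import Summits.ValiantsHypothesis.ValiantsHypothesis.Theorems.DivisionGapPerDivisionHardSparse
import Summits.ValiantsHypothesis.ValiantsHypothesis.Theorems.DivisionGapPerDivisionHardSubexpSparse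

/-!
# Crux `DivisionGap.PerDivisionHard` (stmt-ValiantsHypothesis-5065) — the SPARSE-FIBRE RUNGS (descent across scales)

`PerDivisionHard` asks, for every `c` and all large `n`, that every nonzero cofactor
`h ∈ ℝ≥0[x_ij]` satisfies `2^{(log₂ n + c)^c} < L(per_n · h) + L(h)` (monotone fan-in-two
`complexity` over `ℝ≥0`).  Line `pair-descent-jss-endpoint`
(`Cruxes/PerDivisionHard/Lines/pair_descent_jss_endpoint.lean`, skeleton v8) degenerates the pair
onto the face of the Birkhoff polytope cut out by a placed block graph `G = G(b,k) ⊕ M₀`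
(`placedBlock eR eC`, cut out by a weight `w`, `CutsOut w G`): `top_w (per_n · h) = per_G · top_w h`.
Seats c0–c3 used this ONCE, at a polylog block, and needed the fibre `top_w h` to have a single
`G`-part.  The DESCENT ACROSS SCALES of seat c4 observes that the phase projection `blockSubst eR eC`
(hub edge `(i, (i,j,0)) ↦ X (i,j)`, every other variable `↦ 1`) maps the whole degenerate PAIR to a
cheap nonzero pair `(per_b · h♭, h♭)` at size `b` with `#supp h♭ ≤ #supp (top_w h)`
(`stub_descent`, `stub_blockSubstFacePer`), so every rung of the crux already in the tree re-applies
to the projected fibre at size `b`, provided the block is LARGE (`n ≤ b^a`; level matching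
`stub_fibreArith`).  With the landed sparse rungs as the size-`b` endpoint this gives:

* `perDivisionHard_sparseFibre` — the inequality for every nonzero `h` such that on SOME placed
  block face with `n ≤ b^a`, under SOME weight cutting it out, the top fibre of `h` has at most
  `2^{(log₂ n + c)^c}` monomials (any `k, m`, any cost, no torus hypothesis); the face `K_{n,n}`
  itself (`b = n`, `k = m = 0`, `a = 1`, `w = 0`) gives back the sparse rung
  `perDivisionHard_sparse`;
* `perDivisionHard_subexpFibre` — the same with at most `2^{b/(log₂ b + e)^e}` fibre monomials.

Consequence for the open core of the line: a counterexample to the crux must carry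
super-quasi-polynomially MANY fibre monomials under EVERY admissible weight on EVERY large placed
block face — per-like richness everywhere —, not merely two `G`-parts on polylog blocks.
-/

noncomputable section

-- `Summit.ValiantsHypothesis.ValiantsHypothesis.…` is the tree's mandated single-conjunct layout
-- (Sub = Summit), so the duplicated namespace component is intended.
set_option linter.dupNamespace false

namespace Summit.ValiantsHypothesis.ValiantsHypothesis.Theorems.DivisionGapPerDivisionHard

open MvPolynomial Literature.Computability.AlgebraicComplexity
open Summit.ValiantsHypothesis.ValiantsHypothesis.Theorems.ZeroOneTransfer.Negative (topComponent)
open scoped NNReal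

/-- **The sparse-fibre rung of `PerDivisionHard` (descent across scales).**  For all `a, c` there
is `n₀` such that for `n ≥ n₀` and every nonzero `h ∈ ℝ≥0[x_ij]`: if on SOME placed block face
`placedBlock eR eC` (`eR eC : BlockV b k m ≃ Fin n`) with `n ≤ b^a`, under SOME weight `w` cutting
it out, the top-`w` fibre of `h` has at most `2^{(log₂ n + c)^c}` monomials, then
`2^{(log₂ n + c)^c} < L(per_n · h) + L(h)`.  Proof: the size-`b` pair of `stub_descent` is
nonzero, no more expensive in either complexity, its cofactor has at most as many monomials as the
fibre, its first factor is `per_b` (`stub_blockSubstFacePer`); the sparse rung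
`perDivisionHard_sparse` at size `b` and level `c₁` (`stub_fibreArith`) beats `2^{(log₂ n + c)^c}`.
[folklore] -/
theorem perDivisionHard_sparseFibre :
    ∀ a c : ℕ, ∃ n₀ : ℕ, ∀ n ≥ n₀, ∀ h : MvPolynomial (Fin n × Fin n) ℝ≥0, h ≠ 0 →
      (∃ (b k m : ℕ) (eR eC : BlockV b k m ≃ Fin n) (w : Fin n × Fin n → ℕ),
        CutsOut w (placedBlock eR eC) ∧ n ≤ b ^ a ∧
        (topComponent w h).support.card ≤ 2 ^ ((Nat.log 2 n + c) ^ c)) →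
      2 ^ ((Nat.log 2 n + c) ^ c) < complexity (perPoly (Fin n) ℝ≥0 * h) + complexity h := by
  intro a c
  obtain ⟨c₁, hc₁⟩ := stub_fibreArith a c
  obtain ⟨n₁, hsparse⟩ := perDivisionHard_sparse c₁
  refine ⟨n₁ ^ a + 2, ?_⟩
  rintro n hn h hh ⟨b, k, m, eR, eC, w, hcut, hnb, hcard⟩
  have ha : a ≠ 0 := by
    rintro rfl
    rw [pow_zero] at hnb
    omega
  have hb : n₁ ≤ b :=
    (Nat.pow_le_pow_iff_left ha).mp (le_trans (le_trans (Nat.le_add_right _ _) hn) hnb)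
  obtain ⟨h', hh', hle1, hle2, hsupp⟩ := stub_descent b k m n eR eC w h hcut hh
  rw [stub_blockSubstFacePer] at hle1
  have hlev : 2 ^ ((Nat.log 2 n + c) ^ c) ≤ 2 ^ ((Nat.log 2 b + c₁) ^ c₁) :=
    Nat.pow_le_pow_right two_pos (hc₁ n b hnb)
  calc 2 ^ ((Nat.log 2 n + c) ^ c) ≤ 2 ^ ((Nat.log 2 b + c₁) ^ c₁) := hlev
    _ < complexity (perPoly (Fin b) ℝ≥0 * h') + complexity h' :=
        hsparse b hb h' hh' (hsupp.trans (hcard.trans hlev))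
    _ ≤ complexity (perPoly (Fin n) ℝ≥0 * h) + complexity h := Nat.add_le_add hle1 hle2

/-- **The subexponential-fibre rung of `PerDivisionHard` (descent across scales).**  For all
`a, c` there are `e, n₀` such that for `n ≥ n₀` and every nonzero `h`: if on some placed block face
with `n ≤ b^a`, under some weight cutting it out, the top fibre of `h` has at most
`2^{b/(log₂ b + e)^e}` monomials, then `2^{(log₂ n + c)^c} < L(per_n · h) + L(h)`.  Same proof with
the sub-exponential sparse rung `perDivisionHard_subexpSparse` as the size-`b` endpoint. [folklore] -/
theorem perDivisionHard_subexpFibre :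
    ∀ a c : ℕ, ∃ e n₀ : ℕ, ∀ n ≥ n₀, ∀ h : MvPolynomial (Fin n × Fin n) ℝ≥0, h ≠ 0 →
      (∃ (b k m : ℕ) (eR eC : BlockV b k m ≃ Fin n) (w : Fin n × Fin n → ℕ),
        CutsOut w (placedBlock eR eC) ∧ n ≤ b ^ a ∧
        (topComponent w h).support.card ≤ 2 ^ (b / (Nat.log 2 b + e) ^ e)) →
      2 ^ ((Nat.log 2 n + c) ^ c) < complexity (perPoly (Fin n) ℝ≥0 * h) + complexity h := by
  intro a c
  obtain ⟨c₁, hc₁⟩ := stub_fibreArith a c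
  obtain ⟨e, n₁, hsparse⟩ := perDivisionHard_subexpSparse c₁
  refine ⟨e, n₁ ^ a + 2, ?_⟩
  rintro n hn h hh ⟨b, k, m, eR, eC, w, hcut, hnb, hcard⟩
  have ha : a ≠ 0 := by
    rintro rfl
    rw [pow_zero] at hnb
    omega
  have hb : n₁ ≤ b :=
    (Nat.pow_le_pow_iff_left ha).mp (le_trans (le_trans (Nat.le_add_right _ _) hn) hnb)
  obtain ⟨h', hh', hle1, hle2, hsupp⟩ := stub_descent b k m n eR eC w h hcut hh
  rw [stub_blockSubstFacePer] at hle1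
  have hlev : 2 ^ ((Nat.log 2 n + c) ^ c) ≤ 2 ^ ((Nat.log 2 b + c₁) ^ c₁) :=
    Nat.pow_le_pow_right two_pos (hc₁ n b hnb)
  calc 2 ^ ((Nat.log 2 n + c) ^ c) ≤ 2 ^ ((Nat.log 2 b + c₁) ^ c₁) := hlev
    _ < complexity (perPoly (Fin b) ℝ≥0 * h') + complexity h' :=
        hsparse b hb h' hh' (hsupp.trans hcard)
    _ ≤ complexity (perPoly (Fin n) ℝ≥0 * h) + complexity h := Nat.add_le_add hle1 hle2

end Summit.ValiantsHypothesis.ValiantsHypothesis.Theorems.DivisionGapPerDivisionHard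

end
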